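import Summits.AtomisticToContinuum.FouriersLaw.Theses.HonestZwanzig
import Summits.AtomisticToContinuum.FouriersLaw.Theorems.HonestZwanzigNetworkReductionPackage
import Summits.AtomisticToContinuum.FouriersLaw.Theorems.HonestZwanzigGeneratorSiteEnergy
import Summits.AtomisticToContinuum.FouriersLaw.Theorems.HonestZwanzigParityStatics
import Summits.AtomisticToContinuum.FouriersLaw.Theorems.HonestZwanzigRobinCoercivityStubFeshbachIdentities
import Summits.AtomisticToContinuum.FouriersLaw.Theorems.HonestZwanzigRobinCoercivityStubFeshbachMatrix
import Summits.AtomisticToContinuum.FouriersLaw.Theorems.HonestZwanzigRobinCoercivityStubGramDuality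
import Summits.AtomisticToContinuum.FouriersLaw.Theorems.HonestZwanzigRobinCoercivityStubRobinIncidence

/-!
# `HonestZwanzig.RobinCoercivity` — reduction to the N-uniform flux bound (line LinAlg, card gradient-gram-schur-test)

Support file for the crux `stmt-AtomisticToContinuum-12695` (`RobinCoercivity` of route `HonestZwanzig`, sub-problem
`FouriersLaw`). Two theorems, both sorry-free:

* `robin_fixedN` — at fixed `N ≥ 2` and `s > 0`, for the canonical gadgets of the route (abstract `corr, lap, cov, e, G,
  schur, F` with their defining equations as hypotheses, instantiated by `rfl`), the fixed-`N` package of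
  `FeshbachIdentities`, `GeneratorSiteEnergy`, `ParityStatics`, positive definiteness of `Cov(e,e)` and `G(s)`, and the
  FLUX BOUND with constant `K` at this `(N, s)` — `Σ_{x,y} a_x lap_s(e_x,e_y) a_y ≤ K (Σ_{b+1<N} ψ_b² + φ₀² + φ₁²)` whenever
  the static charge `Σ_y Cov(e_x,e_y) a_y` is the discrete divergence of the bond flux `ψ` plus the contact injections
  `φ₀, φ₁` — imply Robin coercivity of the Feshbach matrix with constant `K⁻¹`:
  `K⁻¹ (Σ_b (ξ_{b+1} − ξ_b)² + ξ_0² + ξ_{N−1}²) ≤ ξᵀ𝔽_N(s)ξ`. Ingredients: `𝔽 = χG⁻¹χ` (`stub_feshbachMatrix` with the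
  Kolmogorov identities `pkg_K1/K2/K3` of `NetworkReduction.Package`), the Robin incidence matrix on `Fin N ⊕ Fin 2`
  (`stub_robinIncidence`) and Gram duality (`stub_gramDuality`).
* `robinCoercivity_of_fluxBound` — hence the route decl `RobinCoercivity` follows from the N-UNIFORM flux bound (the
  hypothesis `hfluxN`, stated over abstract gadgets `lap, cov, e` with defining equations; it is the registered stub
  `stub_fluxBound` of the line's skeleton `Cruxes/RobinCoercivity/Lines/LinAlg.lean`), with `c = K⁻¹`, using the landed
  `FeshbachIdentities` (`stub_feshbachIdentities`), `generatorSiteEnergy_proof` and `parityStatics_proof`.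

The flux bound is EQUIVALENT to the crux given the fixed-`N` package (polar decomposition both ways), so this file is the
lossless transfer `C⁺ → RobinCoercivity` of the line; the N-uniform input itself (a uniform `H₋₁`/Thomson bound for
energy-profile fluctuations of the anharmonic pinned chain) is open.
-/

noncomputable section

open MeasureTheory Finset Matrix
open Literature.MathematicalPhysics.KineticTheory.HeatConduction
open Summit.AtomisticToContinuum.FouriersLaw.Theses.HonestZwanzig
open Summit.AtomisticToContinuum.FouriersLaw.Theorems.HonestZwanzig.NetworkReduction

namespace Summit.AtomisticToContinuum.FouriersLaw.Theorems.HonestZwanzig.Robin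

/-! ### Composition at fixed `N` and `s` (abstract gadgets with defining equations) -/

section FixedN

variable {ω₂ lam β γ : ℝ} {N : ℕ} {T : ℝ}
  {Adm : (PhaseSpace N → ℝ) → Prop}
  {corr : (PhaseSpace N → ℝ) → (PhaseSpace N → ℝ) → ℝ → ℝ}
  {lap : ℝ → (PhaseSpace N → ℝ) → (PhaseSpace N → ℝ) → ℝ}
  {cov : (PhaseSpace N → ℝ) → (PhaseSpace N → ℝ) → ℝ}
  {e : Fin N → PhaseSpace N → ℝ}
  (hAdm : ∀ f, Adm f ↔ (Continuous f ∧ ∃ A : ℝ, ∀ z,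
    |f z| ≤ A * Real.exp ((pinnedChain ω₂ lam β γ).hamiltonian N z / (8 * T))))
  (hcorr : ∀ f g t, corr f g t =
    (∫ z, f z * (∫ y, g y ∂((pinnedChain ω₂ lam β γ).transitionKernel N T T t.toNNReal z))
      ∂(pinnedChain ω₂ lam β γ).gibbsMeasure N T) -
    (∫ z, f z ∂(pinnedChain ω₂ lam β γ).gibbsMeasure N T) *
      (∫ z, g z ∂(pinnedChain ω₂ lam β γ).gibbsMeasure N T))
  (hlap : ∀ s f g, lap s f g = ∫ t in Set.Ioi (0 : ℝ), Real.exp (-(s * t)) * corr f g t)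
  (hcov : ∀ f g, cov f g = (∫ z, f z * g z ∂(pinnedChain ω₂ lam β γ).gibbsMeasure N T) -
    (∫ z, f z ∂(pinnedChain ω₂ lam β γ).gibbsMeasure N T) *
      (∫ z, g z ∂(pinnedChain ω₂ lam β γ).gibbsMeasure N T))
  (he : ∀ x z, e x z = z.2 x ^ 2 / 2 + (pinnedChain ω₂ lam β γ).U (z.1 x) +
    ∑ j : Fin N, ((if j.val = x.val + 1 then (pinnedChain ω₂ lam β γ).V (z.1 j - z.1 x) / 2 else 0) +
      (if x.val = j.val + 1 then (pinnedChain ω₂ lam β γ).V (z.1 x - z.1 j) / 2 else 0)))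
  (hFI : ∀ f g : PhaseSpace N → ℝ, Adm f → Adm g →
    Integrable f ((pinnedChain ω₂ lam β γ).gibbsMeasure N T) ∧
    (∀ t : ℝ, 0 ≤ t → Integrable (fun z => f z *
      (∫ y, g y ∂((pinnedChain ω₂ lam β γ).transitionKernel N T T t.toNNReal z)))
      ((pinnedChain ω₂ lam β γ).gibbsMeasure N T)) ∧
    IntegrableOn (corr f g) (Set.Ioi 0) ∧
    (∀ t : ℝ, 0 ≤ t → corr f g t = corr (fun z => g (z.1, -z.2)) (fun z => f (z.1, -z.2)) t) ∧
    (∀ s : ℝ, 0 < s → ∀ x : Fin N,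
      s * lap s (e x) g - cov (e x) g =
        lap s (fun z => (pinnedChain ω₂ lam β γ).generator N T T (e x) (z.1, -z.2)) g ∧
      s * lap s f (e x) - cov f (e x) = lap s f ((pinnedChain ω₂ lam β γ).generator N T T (e x))))
  (hGSE : ∀ (x : Fin N) (z : PhaseSpace N), (pinnedChain ω₂ lam β γ).generator N T T (e x) z =
    (∑ b : Fin N, ((if x.val = b.val + 1 then (pinnedChain ω₂ lam β γ).bondCurrent N b z else 0) -
      (if b = x then (pinnedChain ω₂ lam β γ).bondCurrent N b z else 0))) +
    (if x.val = 0 then (pinnedChain ω₂ lam β γ).γ * (T - z.2 x ^ 2) else 0) +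
    (if x.val = N - 1 then (pinnedChain ω₂ lam β γ).γ * (T - z.2 x ^ 2) else 0))
  (hPS : ∀ x y : Fin N, cov (e x) ((pinnedChain ω₂ lam β γ).generator N T T (e y)) =
    -(if x = y ∧ (x.val = 0 ∨ x.val = N - 1) then (pinnedChain ω₂ lam β γ).γ * T ^ 2 else 0))
  (hω : 0 < ω₂) (hl : 0 ≤ lam) (hβ : 0 ≤ β) (hγ : 0 ≤ γ) (hT : 0 < T)

include hAdm hlap hcov hFI he hGSE hPS hω hl hβ hT in
/-- **Robin coercivity at fixed `N` and `s` from the flux bound.** Under the fixed-`N` package, positive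
definiteness of `Cov(e,e)` and `G(s)`, and the flux bound with constant `K` at this `(N, s)`, the Feshbach
matrix dominates `K⁻¹ ×` the Robin form. -/
theorem robin_fixedN (hN : 2 ≤ N) {s : ℝ} (hs : 0 < s)
    (G : Matrix (Fin N) (Fin N) ℝ) (hG : ∀ x y, G x y = lap s (e x) (e y))
    (schur : (PhaseSpace N → ℝ) → (PhaseSpace N → ℝ) → ℝ)
    (hschur : ∀ f g, schur f g = lap s f g - ∑ x, ∑ y, lap s f (e x) * G⁻¹ x y * lap s (e y) g)
    (F : Fin N → Fin N → ℝ)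
    (hF : ∀ x y, F x y = s * cov (e x) (e y) - cov (e x) ((pinnedChain ω₂ lam β γ).generator N T T (e y)) -
      schur (fun z => (pinnedChain ω₂ lam β γ).generator N T T (e x) (z.1, -z.2))
        ((pinnedChain ω₂ lam β γ).generator N T T (e y)))
    (hGp : ∀ v : Fin N → ℝ, v ≠ 0 → 0 < ∑ x, ∑ y, v x * G x y * v y)
    (hCp : ∀ v : Fin N → ℝ, v ≠ 0 → 0 < ∑ x, ∑ y, v x * cov (e x) (e y) * v y)
    {K : ℝ} (hK : 0 < K)
    (hflux : ∀ (a ψ : Fin N → ℝ) (φ₀ φ₁ : ℝ),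
      (∀ x : Fin N, ∑ y : Fin N, cov (e x) (e y) * a y =
        (∑ b : Fin N, if b.val + 1 < N then
          ((if x.val = b.val + 1 then ψ b else 0) - (if x = b then ψ b else 0)) else 0) +
        (if x.val = 0 then φ₀ else 0) + (if x.val = N - 1 then φ₁ else 0)) →
      ∑ x : Fin N, ∑ y : Fin N, a x * lap s (e x) (e y) * a y ≤
        K * ((∑ b : Fin N, if b.val + 1 < N then ψ b ^ 2 else 0) + φ₀ ^ 2 + φ₁ ^ 2))
    (ξ : Fin N → ℝ) :
    K⁻¹ * (∑ i : Fin N, ((∑ j : Fin N, if j.val = i.val + 1 then (ξ j - ξ i) ^ 2 else 0) +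
      (if i.val = 0 then ξ i ^ 2 else 0) + (if i.val = N - 1 then ξ i ^ 2 else 0))) ≤
      ∑ x, ∑ y, ξ x * F x y * ξ y := by
  classical
  -- the static covariance matrix
  set χ : Matrix (Fin N) (Fin N) ℝ := Matrix.of fun x y => cov (e x) (e y) with hχ
  have hχa : ∀ x y, χ x y = cov (e x) (e y) := fun x y => rfl
  have hGsym : ∀ x y, G x y = G y x := fun x y => by
    rw [hG, hG, pkg_G_symm hAdm hlap he hFI hω hl hβ hT s]
  have hχsym : ∀ x y, χ x y = χ y x := fun x y => by rw [hχa, hχa, cov_comm hcov]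
  have hGpd : G.PosDef := posDef_of_symm_of_pos G hGsym hGp
  have hχpd : χ.PosDef := posDef_of_symm_of_pos χ hχsym (fun v hv => by
    simpa only [hχa] using hCp v hv)
  -- (1) the Feshbach matrix is the Schur complement
  have hquad : ∑ x, ∑ y, ξ x * F x y * ξ y = (χ *ᵥ ξ) ⬝ᵥ (G⁻¹ *ᵥ (χ *ᵥ ξ)) := by
    refine stub_feshbachMatrix s G χ (Matrix.of fun x y =>
        cov (e x) ((pinnedChain ω₂ lam β γ).generator N T T (e y)))
      (fun x y => lap s (fun z => (pinnedChain ω₂ lam β γ).generator N T T (e x) (z.1, -z.2)) (e y))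
      (fun x y => lap s (e x) ((pinnedChain ω₂ lam β γ).generator N T T (e y)))
      (fun x y => lap s (fun z => (pinnedChain ω₂ lam β γ).generator N T T (e x) (z.1, -z.2))
        ((pinnedChain ω₂ lam β γ).generator N T T (e y)))
      F hGpd hχsym (fun x y => ?_) (fun x y => ?_) (fun x y => ?_) (fun x y => ?_) ξ
    · rw [pkg_K1 hAdm he hFI hω hl hβ hT hs, hG, hχa]
    · rw [pkg_K2 hAdm he hFI hω hl hβ hT hs, hG, hχa]
    · rw [pkg_K3 hAdm hlap hcov he hFI hGSE hPS hω hl hβ hT hs, hG, hχa, Matrix.of_apply]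
    · rw [hF, hschur, hχa, Matrix.of_apply]
  -- (2) the Robin incidence matrix
  set B : Matrix (Fin N ⊕ Fin 2) (Fin N) ℝ := Matrix.of fun r x => Sum.elim
      (fun b : Fin N => if x.val = b.val + 1 then (1 : ℝ) else if x = b ∧ b.val + 1 < N then -1 else 0)
      (fun i : Fin 2 => if (i = 0 ∧ x.val = 0) ∨ (i = 1 ∧ x.val = N - 1) then (1 : ℝ) else 0) r with hBdef
  obtain ⟨hBrob, hBdiv, hBnorm⟩ := stub_robinIncidence hN B (fun r x => rfl)
  -- (3) the flux bound in matrix form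
  have hgram : ∀ (a : Fin N → ℝ) (w : Fin N ⊕ Fin 2 → ℝ), χ *ᵥ a = Bᵀ *ᵥ w →
      a ⬝ᵥ (G *ᵥ a) ≤ K * (w ⬝ᵥ w) := by
    intro a w hw
    have hw' : w = Sum.elim (w ∘ Sum.inl) (w ∘ Sum.inr) := (Sum.elim_comp_inl_inr w).symm
    set ψ : Fin N → ℝ := w ∘ Sum.inl with hψ
    set φ : Fin 2 → ℝ := w ∘ Sum.inr with hφ
    have hdiv : ∀ x : Fin N, ∑ y : Fin N, cov (e x) (e y) * a y =
        (∑ b : Fin N, if b.val + 1 < N then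
          ((if x.val = b.val + 1 then ψ b else 0) - (if x = b then ψ b else 0)) else 0) +
        (if x.val = 0 then φ 0 else 0) + (if x.val = N - 1 then φ 1 else 0) := by
      intro x
      have h1 := congrFun hw x
      rw [hw'] at h1
      rw [hBdiv ψ φ x] at h1
      rw [← h1]
      simp only [Matrix.mulVec, dotProduct, hχa]
    have hb := hflux a ψ (φ 0) (φ 1) hdiv
    have hlhs : a ⬝ᵥ (G *ᵥ a) = ∑ x : Fin N, ∑ y : Fin N, a x * lap s (e x) (e y) * a y := by
      rw [← sum_sum_eq_dotProduct_mulVec]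
      simp only [hG]
    have hrhs : (∑ b : Fin N, if b.val + 1 < N then ψ b ^ 2 else 0) + φ 0 ^ 2 + φ 1 ^ 2 ≤ w ⬝ᵥ w := by
      rw [hw', hBnorm ψ φ]
      have : (∑ b : Fin N, if b.val + 1 < N then ψ b ^ 2 else 0) ≤ ∑ b, ψ b ^ 2 :=
        Finset.sum_le_sum fun b _ => by split_ifs <;> nlinarith [sq_nonneg (ψ b)]
      linarith
    rw [hlhs]
    exact hb.trans (mul_le_mul_of_nonneg_left hrhs hK.le)
  -- (4) Gram duality
  have hdual := stub_gramDuality B G χ hGpd hχpd hK hgram ξ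
  rw [hBrob ξ] at hdual
  rw [hquad]
  exact hdual

end FixedN

/-! ### The crux from the N-uniform flux bound -/

/-- **`RobinCoercivity` from the N-uniform flux bound** (line LinAlg of crux stmt-AtomisticToContinuum-12695): if there is
`K > 0` such that for every `N ≥ 2` and all small `s > 0` the Laplace-transformed autocorrelation of every energy-profile
fluctuation `Σ a_x ẽ_x` is at most `K ×` the dissipation `Σ_{b+1<N} ψ_b² + φ₀² + φ₁²` of any bond/contact flux whose
divergence is its static charge `Cov(e,e)a`, then the Feshbach matrix of the route is Robin-coercive uniformly in `N` with
`c = K⁻¹`. -/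
theorem robinCoercivity_of_fluxBound (hfluxN : ∀ ω₂ lam β γ : ℝ, 0 < ω₂ → 0 < lam → 0 < β → 0 < γ → ∀ T : ℝ, 0 < T →
    ∃ K : ℝ, 0 < K ∧ ∀ N : ℕ, 2 ≤ N → ∃ s₀ : ℝ, 0 < s₀ ∧
    ∀ (lap : ℝ → (PhaseSpace N → ℝ) → (PhaseSpace N → ℝ) → ℝ)
      (cov : (PhaseSpace N → ℝ) → (PhaseSpace N → ℝ) → ℝ) (e : Fin N → PhaseSpace N → ℝ),
    (∀ s f g, lap s f g = ∫ t in Set.Ioi (0 : ℝ), Real.exp (-(s * t)) *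
      ((∫ z, f z * (∫ y, g y ∂((pinnedChain ω₂ lam β γ).transitionKernel N T T t.toNNReal z))
          ∂(pinnedChain ω₂ lam β γ).gibbsMeasure N T) -
        (∫ z, f z ∂(pinnedChain ω₂ lam β γ).gibbsMeasure N T) *
          (∫ z, g z ∂(pinnedChain ω₂ lam β γ).gibbsMeasure N T))) →
    (∀ f g, cov f g = (∫ z, f z * g z ∂(pinnedChain ω₂ lam β γ).gibbsMeasure N T) -
      (∫ z, f z ∂(pinnedChain ω₂ lam β γ).gibbsMeasure N T) *
        (∫ z, g z ∂(pinnedChain ω₂ lam β γ).gibbsMeasure N T)) →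
    (∀ x z, e x z = z.2 x ^ 2 / 2 + (pinnedChain ω₂ lam β γ).U (z.1 x) +
      ∑ j : Fin N, ((if j.val = x.val + 1 then (pinnedChain ω₂ lam β γ).V (z.1 j - z.1 x) / 2 else 0) +
        (if x.val = j.val + 1 then (pinnedChain ω₂ lam β γ).V (z.1 x - z.1 j) / 2 else 0))) →
    ∀ s : ℝ, 0 < s → s < s₀ → ∀ (a ψ : Fin N → ℝ) (φ₀ φ₁ : ℝ),
      (∀ x : Fin N, ∑ y : Fin N, cov (e x) (e y) * a y =
        (∑ b : Fin N, if b.val + 1 < N then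
          ((if x.val = b.val + 1 then ψ b else 0) - (if x = b then ψ b else 0)) else 0) +
        (if x.val = 0 then φ₀ else 0) + (if x.val = N - 1 then φ₁ else 0)) →
      ∑ x : Fin N, ∑ y : Fin N, a x * lap s (e x) (e y) * a y ≤
        K * ((∑ b : Fin N, if b.val + 1 < N then ψ b ^ 2 else 0) + φ₀ ^ 2 + φ₁ ^ 2)) :
    RobinCoercivity := by
  intro ω₂ lam β γ hω hl hβ hγ T hT
  obtain ⟨K, hK, hKN⟩ := hfluxN ω₂ lam β γ hω hl hβ hγ T hT
  refine ⟨K⁻¹, inv_pos.2 hK, fun N hN => ?_⟩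
  obtain ⟨s₀, hs₀, hflux⟩ := hKN N hN
  refine ⟨s₀, hs₀, ?_⟩
  dsimp only
  intro s hs hss ξ
  obtain ⟨-, hFI2, hCp, hGp⟩ := stub_feshbachIdentities ω₂ lam β γ hω hl hβ hγ T hT N hN
  exact robin_fixedN (ω₂ := ω₂) (lam := lam) (β := β) (γ := γ) (N := N) (T := T)
    (corr := fun f g t => (∫ z, f z * (∫ y, g y ∂((pinnedChain ω₂ lam β γ).transitionKernel N T T
      t.toNNReal z)) ∂(pinnedChain ω₂ lam β γ).gibbsMeasure N T) -
      (∫ z, f z ∂(pinnedChain ω₂ lam β γ).gibbsMeasure N T) * (∫ z, g z ∂(pinnedChain ω₂ lam β γ).gibbsMeasure N T))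
    (fun f => Iff.rfl) (fun s f g => rfl) (fun f g => rfl) (fun x z => rfl)
    hFI2 (fun x z => generatorSiteEnergy_proof ω₂ lam β γ N hN T T x z)
    (fun x y => ((parityStatics_proof ω₂ lam β γ hω hl hβ hγ T hT N hN) x).2 y)
    hω hl.le hβ.le hT hN hs _ (fun x y => rfl) _ (fun f g => rfl) _ (fun x y => rfl)
    (hGp s hs) hCp hK (hflux _ _ _ (fun _ _ _ => rfl) (fun _ _ => rfl) (fun _ _ => rfl) s hs hss) ξ


end Summit.AtomisticToContinuum.FouriersLaw.Theorems.HonestZwanzig.Robin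

end
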